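import Literature.Computability.Cryptography.ZhandryModuliCount
import Literature.Computability.QuantumComplexity.FactoringPrimesProofs
import Literature.Computability.Complexity.NatSqrtFP
import Literature.Computability.Complexity.PlumbingBricks
import Literature.Computability.Complexity.StackBricksArith
import Literature.Computability.Cryptography.HybridSampling
import Literature.Computability.Cryptography.ZhandryPRFModCollision
import Literature.Computability.Complexity.OracleQueryMap
import HarnessLib

/-!
# Zhandry's `PRF^mod`, III: the modulus sampler, the reduction, and Aaronson–Chen 2017, Lemma 7.5 (1)

Topic `Literature/Computability/Cryptography`. Third and last layer — after `ZhandryPRFMod.lean`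
(the construction and the named facts), `PRPSwitchingLemma.lean` (first half of Lemma 7.5 (1):
`aaronsonChen2017_lem75_prp_isPRF_holds`), `ZhandryPRFModCollision.lean` (the information-theoretic
step) and `ZhandryModuliCount.lean` (the arithmetic of the moduli) — below the named fact
`aaronsonChen2017_lem75_prfMod_isPRF` of S. Aaronson, L. Chen, *Complexity-theoretic foundations of
quantum supremacy experiments*, CCC 2017 (arXiv:1612.05903), Lemma 7.5 (1), second half ("`PRF^mod`
is a classical secure PRF"; M. Zhandry, FOCS 2012, Claim 1), which is DISCHARGED here:
`theorem aaronsonChen2017_lem75_prfMod_isPRF_holds`.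

**The printed proof** (App. 13, p. 42, read via `lit read arxiv:1612.05903`): "We first show that
if the `PRP^raw` in the definition of `PRF^mod` were replaced by a truly random function, then no
classical polynomial-time algorithm `A` could distinguish it from a truly random function with a
non-negligible advantage. […] the total probability of querying two `x` and `x'` such that
`x ≡ x' (mod a)` is at most `O(q² log N/√N)` […]. Since `PRP^raw` is a classical secure PRF, the
advantage can only change negligibly when `PRP^raw` is put back, `|Pr_{f ← PRF^mod_{K^mod}}[A^f() = 1]
− Pr_{f ← X^X}[A^f() = 1]| < ε` for any polynomial-time algorithm `A`."

**What is formalized here** (the COMPUTATIONAL step "the advantage can only change negligibly when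
`PRP^raw` is put back", which in the tree's uniform model needs an explicit probabilistic
polynomial-time reduction that samples the modulus `a ← A` itself, and the assembly):

* `ZhandrySampler.samp m T ρ` — rejection sampling of a modulus from a coin string `ρ`: the value
  of the first of `T` consecutive `⌊m/2⌋`-bit blocks of `ρ` lying in `A = zhandryModuli (2^m)`
  (the primes in `[⌊√N⌋/4, ⌊√N⌋/2]`, `N = 2^m`; all `< 2^{⌊m/2⌋}`, `lt_two_pow_bw_of_mem`), else `0`;
  its LAW under uniform coins (`uniformAvg_samp`): for every test function `g`,
  `E_ρ g(samp) = (1 − θ) · avg_{a ∈ A} g(a) + θ · g(0)`, `θ = (1 − |A|/2^{⌊m/2⌋})^T ≤ exp(−T|A|/2^{⌊m/2⌋})`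
  (`abs_uniformAvg_samp_sub_avg_le`, `miss_pow_le_exp`);
* `ZhandrySampler.sampF ∈ FP` — the sampler as a polynomial-time string function in the brick
  algebra of `Complexity/BrickAlgebra.lean` (`sampF_apply`, `sampF_mem_FP`): a counted loop
  (`loopFn_mem_FP`) over the blocks whose acceptance test is the window test (`ltFn` against the
  numerals `⌊√N⌋/4`, `⌊√N⌋/2` computed by `Brick.natSqrt_mem_FP` and `divFn`) AND the AKS primality
  test `QuantumComplexity.AKSMachine.aksFn` (`PRIMES ∈ P`, `FactoringPrimesProofs.lean`);
* `ZhandrySampler.dF c ∈ FP` — the query map `⟨⟨1ⁿ, r⟩, ⟨as, q⟩⟩ ↦ q mod a` (as an `|q|`-bit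
  string, `modReduce`), `a` sampled by `sampF` from the coins `r ⇂ c(n)` (`dF_apply`, `dF_mem_FP`);
* `ZhandrySampler.redAdv 𝒜 S` — **the reduction adversary** `B`: `c(n) + S(n)` coins, runs `𝒜` on
  the first `c(n)` coins (`OracleAlg.comap (truncSndFn c)`) with every query rewritten by `dF`
  (`OracleAlg.mapQuery`), PPT when `𝒜` is (`isPPT_redAdv`); against a length-`m` function oracle
  `O` its run with coins `r` IS the run of `𝒜` with coins `r ↾ c(n)` against `reduceOracle a O`
  (`run_redAdv`), whence `Pr[B^O = 1] = E_ρ Pr[𝒜^{O ∘ (mod samp ρ)} = 1]` (`acceptProb_redAdv`) and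
  `|Pr[B^O = 1] − avg_{a ∈ A} Pr[𝒜^{O ∘ (mod a)} = 1]| ≤ θ` (`abs_acceptProb_redAdv_sub_avg_le`);
  in the two games: `|Pr_k[B^{F_k} = 1] − Pr_{(k,a)}[𝒜^{PRF^mod_{(k,a)}} = 1]| ≤ θ`
  (`abs_prfRealProb_redAdv_sub_prfModRealProb_le`, by `oracleOfFnAt_prfMod`) and
  `|Pr_H[B^H = 1] − avg_a Pr_H[𝒜^{H ∘ (mod a)} = 1]| ≤ θ` (`abs_prfIdealProb_redAdv_sub_avg_le`);
* the assembly `aaronsonChen2017_lem75_prfMod_isPRF_holds`: with `S(n) = 8 Q(n)³` coins for the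
  polynomial bound `Q` on `ℓ` (`IsEfficientFamily`), so that `T ≥ 16 m²` blocks are scanned, and the
  prime number theorem in the form `⌊√N⌋ ≤ 16 m |A|` (`exists_sqrt_le_mul_card_zhandryModuli`),
  `θ ≤ e^{−m} ≤ e^{−n}` (`miss_le_exp_neg`); the advantage of `𝒜` against `PRF^mod` is at most
  `θ + (PRF advantage of B against F) + θ + fuel(n)² · 2/|A|` — the second term negligible because a
  secure PRP with `ℓ n ≥ n` is a secure PRF (`IsPRP.isPRF_of_le`), the last by
  `abs_avg_prfIdealModProb_sub_prfIdealProb_le` with `card_filter_modEq_zhandryModuli_le_two` and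
  `1/|A| ≤ 16 m/⌊√N⌋ ≤ 16 Q(n)/2^{⌊n/2⌋}` (`exists_inv_card_zhandryModuli_le`).

Deviation from the printed text: the paper treats `a ← A` as part of the key and says nothing
about how a reduction obtains it; in the tree's model of UNIFORM probabilistic polynomial-time
adversaries (`OracleAdversary.IsPPT`) the reduction must sample `a` from its own coins, which is
where `PRIMES ∈ P` (Agrawal–Kayal–Saxena 2004) and the rejection-sampling error `θ` enter. No new
named fact is introduced (D-0026); everything in this file is proved.

## References

* [AaronsonChen2017] S. Aaronson, L. Chen, CCC 2017 (arXiv:1612.05903): §7.1 Def. 7.2, §7.2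
  (p. 29), Lemma 7.5 (p. 30), App. 13 (proof of Lemma 7.5, p. 42).
* [Zhandry2012] M. Zhandry, *How to construct quantum random functions*, FOCS 2012, Claim 1 (the
  original statement; cited through [AaronsonChen2017]).
* [AgrawalKayalSaxena2004] M. Agrawal, N. Kayal, N. Saxena, *PRIMES is in P*, Ann. of Math. 160
  (2004), Thm 4.1 and Thm 5.1 (the primality test of the sampler; tree: `PRIMES_mem_P_holds`).
* [AroraBarakCC2009] S. Arora, B. Barak, *Computational Complexity: A Modern Approach*, CUP 2009,
  §1.3 (closure of polynomial time under composition and bounded loops), §3.4 (oracle machines),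
  §7.4 (randomised reductions).
* [Goldreich2001] O. Goldreich, *Foundations of Cryptography I*, CUP 2001, §3.6, Def. 3.6.4
  (probabilistic polynomial-time oracle machines; the PRF game).
-/

noncomputable section

namespace Literature.Computability.Cryptography

open Filter Asymptotics _root_.Computability Complexity Complexity.Brick Finset

namespace ZhandrySampler

/-! ### The candidate window: block width `⌊m/2⌋` -/

/-- The block width of the sampler for domain size `N = 2^m`: candidates are `⌊m/2⌋`-bit numbers,
an interval `[0, 2^{⌊m/2⌋})` containing `[0, ⌊√N⌋/2]` and of size at most `⌊√N⌋`.
[cite: AaronsonChen2017, §7.2 (p. 29)] -/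
def bw (m : ℕ) : ℕ := m / 2

/-- `2^{⌊m/2⌋} ≤ ⌊√(2^m)⌋`. [folklore] -/
theorem two_pow_bw_le_sqrt (m : ℕ) : 2 ^ bw m ≤ Nat.sqrt (2 ^ m) := by
  rw [bw, Nat.le_sqrt, ← pow_add]
  exact Nat.pow_le_pow_right (by norm_num) (by omega)

/-- `⌊√(2^m)⌋ / 2 < 2^{⌊m/2⌋}`: the upper end of Zhandry's window fits in a block. [folklore] -/
theorem sqrt_two_pow_div_two_lt (m : ℕ) : Nat.sqrt (2 ^ m) / 2 < 2 ^ bw m := by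
  obtain ⟨j, rfl | rfl⟩ := Nat.even_or_odd' m
  · have hbw : bw (2 * j) = j := by rw [bw]; omega
    have hs : Nat.sqrt (2 ^ (2 * j)) = 2 ^ j := by
      rw [pow_mul, show (2 : ℕ) ^ 2 = 2 * 2 by norm_num, mul_pow, Nat.sqrt_eq]
    rw [hbw, hs]
    exact Nat.div_lt_self (Nat.two_pow_pos j) one_lt_two
  · have hbw : bw (2 * j + 1) = j := by rw [bw]; omega
    have hs : Nat.sqrt (2 ^ (2 * j + 1)) < 2 * 2 ^ j := by
      rw [Nat.sqrt_lt]
      calc 2 ^ (2 * j + 1) < 2 ^ (2 * j + 2) := Nat.pow_lt_pow_right (by norm_num) (by omega)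
        _ = 2 * 2 ^ j * (2 * 2 ^ j) := by ring
    rw [hbw]
    omega

/-- Zhandry's moduli are below `2^{⌊m/2⌋}`. [cite: AaronsonChen2017, §7.2 (p. 29)] -/
theorem lt_two_pow_bw_of_mem {m a : ℕ} (h : a ∈ zhandryModuli (2 ^ m)) : a < 2 ^ bw m :=
  lt_of_le_of_lt (mem_zhandryModuli.1 h).2.1 (sqrt_two_pow_div_two_lt m)

/-- The moduli set sits inside the candidate range. [cite: AaronsonChen2017, §7.2 (p. 29)] -/
theorem zhandryModuli_subset_range (m : ℕ) : zhandryModuli (2 ^ m) ⊆ Finset.range (2 ^ bw m) :=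
  fun _ h => Finset.mem_range.2 (lt_two_pow_bw_of_mem h)

/-- Hence `|A| ≤ 2^{⌊m/2⌋}`. [folklore] -/
theorem card_zhandryModuli_le (m : ℕ) : (zhandryModuli (2 ^ m)).card ≤ 2 ^ bw m := by
  simpa using Finset.card_le_card (zhandryModuli_subset_range m)

/-! ### The scan: rejection sampling over consecutive coin blocks -/

/-- One round of the scan: an empty accumulator (`0`; moduli are primes, hence nonzero) takes the
block's value if that value is one of Zhandry's moduli. [folklore] -/
def pick (m : ℕ) (acc : ℕ) (blk : List Bool) : ℕ :=
  if acc = 0 ∧ bitsToNat blk ∈ zhandryModuli (2 ^ m) then bitsToNat blk else acc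

/-- The scan over `T` consecutive blocks of width `⌊m/2⌋` of the coin string, from the
accumulator `acc`. [folklore] -/
def scan (m : ℕ) : ℕ → List Bool → ℕ → ℕ
  | 0, _, acc => acc
  | T + 1, ρ, acc => scan m T (ρ.drop (bw m)) (pick m acc (ρ.take (bw m)))

/-- **The sampled modulus**: the value of the first of the `T` blocks of `ρ` that is one of
Zhandry's moduli, `0` if there is none. [folklore] -/
def samp (m T : ℕ) (ρ : List Bool) : ℕ := scan m T ρ 0

/-- A nonzero accumulator is never changed. [folklore] -/
theorem pick_of_ne_zero (m : ℕ) {acc : ℕ} (h : acc ≠ 0) (blk : List Bool) : pick m acc blk = acc := by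
  simp [pick, h]

/-- A nonzero accumulator is never changed by the scan. [folklore] -/
theorem scan_of_ne_zero (m : ℕ) : ∀ (T : ℕ) (ρ : List Bool) {acc : ℕ}, acc ≠ 0 → scan m T ρ acc = acc
  | 0, _, _, _ => rfl
  | T + 1, ρ, acc, h => by rw [scan, pick_of_ne_zero m h, scan_of_ne_zero m T _ h]

/-- One more block in front: the first block wins if it is good. [folklore] -/
theorem samp_succ (m T : ℕ) (ρ : List Bool) :
    samp m (T + 1) ρ =
      if bitsToNat (ρ.take (bw m)) ∈ zhandryModuli (2 ^ m) then bitsToNat (ρ.take (bw m))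
      else samp m T (ρ.drop (bw m)) := by
  rw [samp, scan]
  by_cases h : bitsToNat (ρ.take (bw m)) ∈ zhandryModuli (2 ^ m)
  · rw [if_pos h, pick, if_pos ⟨rfl, h⟩]
    exact scan_of_ne_zero m T _ (prime_of_mem_zhandryModuli h).ne_zero
  · rw [if_neg h, pick, if_neg (fun h' => h h'.2)]
    rfl

/-- The sampled modulus is one of Zhandry's moduli or `0`. [folklore] -/
theorem samp_mem_or_eq_zero (m : ℕ) : ∀ (T : ℕ) (ρ : List Bool),
    samp m T ρ ∈ zhandryModuli (2 ^ m) ∨ samp m T ρ = 0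
  | 0, _ => Or.inr rfl
  | T + 1, ρ => by
    rw [samp_succ]
    split_ifs with h
    · exact Or.inl h
    · exact samp_mem_or_eq_zero m T _

/-- The scan only reads the first `T ⌊m/2⌋` coins. [folklore] -/
theorem samp_take (m : ℕ) : ∀ (T : ℕ) (ρ : List Bool) {L : ℕ}, T * bw m ≤ L →
    samp m T (ρ.take L) = samp m T ρ
  | 0, _, _, _ => rfl
  | T + 1, ρ, L, hL => by
    have hw : bw m ≤ L := le_trans (by rw [Nat.succ_mul]; exact Nat.le_add_left _ _) hL
    rw [samp_succ, samp_succ, List.take_take, min_eq_left hw, List.drop_take,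
      samp_take m T _ (by rw [Nat.succ_mul] at hL; omega)]

/-! ### Fixed-width numerals -/

/-- Reading back fixed-width digits (the tree lemma `natBits_bitsToNat` of
`MajorityEnumeration.lean`, not imported here). [folklore] -/
theorem natBits_length_bitsToNat : ∀ l : List Bool, Complexity.natBits l.length (bitsToNat l) = l
  | [] => rfl
  | b :: l => by
    rw [List.length_cons, Complexity.natBits, bitsToNat_cons]
    have h2 : (b.toNat + 2 * bitsToNat l) / 2 = bitsToNat l := by
      cases b <;> simp only [Bool.toNat_false, Bool.toNat_true] <;> omega
    have h1 : decide ((b.toNat + 2 * bitsToNat l) % 2 = 1) = b := by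
      cases b <;>
        simp only [Bool.toNat_false, Bool.toNat_true, decide_eq_true_eq, decide_eq_false_iff_not] <;> omega
    rw [h1, h2, natBits_length_bitsToNat l]

/-- `{0,1}^w ≃ [0, 2^w)` by the little-endian value. [folklore] -/
def valEquiv (w : ℕ) : List.Vector Bool w ≃ Fin (2 ^ w) where
  toFun v := ⟨bitsToNat v.toList, by simpa using bitsToNat_lt v.toList⟩
  invFun i := ⟨Complexity.natBits w i, Complexity.length_natBits _ _⟩
  left_inv v := by
    apply List.Vector.toList_injective
    have h := natBits_length_bitsToNat v.toList
    rw [v.toList_length] at h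
    exact h
  right_inv i := by
    ext
    exact Complexity.bitsToNat_natBits i.2

/-- A sum over `{0,1}^w` of a function of the value is a sum over `[0, 2^w)`. [folklore] -/
theorem sum_vector_eq_sum_range (w : ℕ) (φ : ℕ → ℝ) :
    ∑ v : List.Vector Bool w, φ (bitsToNat v.toList) = ∑ c ∈ Finset.range (2 ^ w), φ c := by
  rw [← Fin.sum_univ_eq_sum_range]
  exact Fintype.sum_equiv (valEquiv w) _ _ fun v => rfl

/-! ### The law of the sampled modulus -/

/-- One block: the average over a uniform `w`-bit block of "`g` of the value if the value is
good, else `C`" is `(∑_{a ∈ A} g a)/2^w + (1 − |A|/2^w) C` for a set `A` of good values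
below `2^w`. [folklore] -/
theorem uniformAvg_ite_mem {w : ℕ} {A : Finset ℕ} (hA : A ⊆ Finset.range (2 ^ w)) (g : ℕ → ℝ) (C : ℝ) :
    uniformAvg w (fun u => if bitsToNat u ∈ A then g (bitsToNat u) else C) =
      (∑ a ∈ A, g a) / 2 ^ w + (1 - A.card / 2 ^ w) * C := by
  unfold uniformAvg
  rw [sum_vector_eq_sum_range w (fun c => if c ∈ A then g c else C), Finset.sum_ite,
    Finset.filter_mem_eq_inter, Finset.inter_eq_right.2 hA, Finset.sum_const, nsmul_eq_mul,
    Finset.filter_not, Finset.filter_mem_eq_inter, Finset.inter_eq_right.2 hA,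
    Finset.card_sdiff_of_subset hA, Finset.card_range, Nat.cast_sub (by simpa using Finset.card_le_card hA)]
  push_cast
  field_simp

/-- **The law of the sampled modulus** (rejection sampling): for a test function `g`, the average
of `g (samp m T ρ)` over uniform coins `ρ ∈ {0,1}^L`, `L ≥ T ⌊m/2⌋`, is the mixture
`(1 − θ) · (uniform average of g over A) + θ · g 0` with `θ = (1 − |A|/2^{⌊m/2⌋})^T`
(the probability that all `T` blocks miss `A = zhandryModuli (2^m)`). [folklore] -/
theorem uniformAvg_samp (m : ℕ) (g : ℕ → ℝ) : ∀ (T L : ℕ), T * bw m ≤ L →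
    uniformAvg L (fun ρ => g (samp m T ρ)) =
      (1 - (1 - (zhandryModuli (2 ^ m)).card / 2 ^ bw m) ^ T) *
          ((∑ a ∈ zhandryModuli (2 ^ m), g a) / (zhandryModuli (2 ^ m)).card) +
        (1 - (zhandryModuli (2 ^ m)).card / 2 ^ bw m) ^ T * g 0
  | 0, L, _ => by simp [samp, scan, uniformAvg_const]
  | T + 1, L, hL => by
    set A := zhandryModuli (2 ^ m) with hAdef
    have hw : bw m ≤ L := le_trans (by rw [Nat.succ_mul]; exact Nat.le_add_left _ _) hL
    obtain ⟨L', rfl⟩ := Nat.exists_eq_add_of_le hw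
    have hL' : T * bw m ≤ L' := by rw [Nat.succ_mul] at hL; omega
    have ih := uniformAvg_samp m g T L' hL'
    -- split the coins into the first block and the rest
    have hsplit : uniformAvg (bw m + L') (fun ρ => g (samp m (T + 1) ρ)) =
        uniformAvg (bw m) fun u => uniformAvg L' fun v =>
          g (if bitsToNat u ∈ A then bitsToNat u else samp m T v) := by
      rw [← uniformAvg_add (bw m) L' fun u v => g (if bitsToNat u ∈ A then bitsToNat u else samp m T v)]
      refine uniformAvg_congr fun ρ hρ => ?_
      rw [samp_succ]
    rw [hsplit]
    have hinner : ∀ u : List Bool,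
        (uniformAvg L' fun v => g (if bitsToNat u ∈ A then bitsToNat u else samp m T v)) =
          if bitsToNat u ∈ A then g (bitsToNat u) else uniformAvg L' fun v => g (samp m T v) := by
      intro u
      split_ifs with h
      · exact uniformAvg_const _ _
      · rfl
    simp_rw [hinner]
    rw [uniformAvg_ite_mem (zhandryModuli_subset_range m), ih]
    -- algebra: `(∑_A g)/2^w = p · avg_A g` (also when `A = ∅`)
    set p : ℝ := (A.card : ℝ) / 2 ^ bw m
    set avg : ℝ := (∑ a ∈ A, g a) / A.card
    have hq : (∑ a ∈ A, g a) / 2 ^ bw m = p * avg := by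
      rcases Nat.eq_zero_or_pos A.card with h0 | hpos
      · have hA0 : A = ∅ := Finset.card_eq_zero.1 h0
        simp [p, avg, hA0]
      · have hc : (A.card : ℝ) ≠ 0 := by exact_mod_cast hpos.ne'
        simp only [p, avg]
        field_simp
    rw [hq]
    ring

/-- The mixture form as an error bound: for `g` with values in `[0,1]`,
`|E_ρ g(samp) − avg_A g| ≤ (1 − |A|/2^{⌊m/2⌋})^T`. [folklore] -/
theorem abs_uniformAvg_samp_sub_avg_le (m : ℕ) {g : ℕ → ℝ} (hg0 : ∀ a, 0 ≤ g a) (hg1 : ∀ a, g a ≤ 1)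
    {T L : ℕ} (hL : T * bw m ≤ L) (hA : (zhandryModuli (2 ^ m)).Nonempty) :
    |uniformAvg L (fun ρ => g (samp m T ρ)) -
        (∑ a ∈ zhandryModuli (2 ^ m), g a) / (zhandryModuli (2 ^ m)).card| ≤
      (1 - (zhandryModuli (2 ^ m)).card / 2 ^ bw m) ^ T := by
  rw [uniformAvg_samp m g T L hL]
  set A := zhandryModuli (2 ^ m)
  set θ : ℝ := (1 - (A.card : ℝ) / 2 ^ bw m) ^ T
  set avg : ℝ := (∑ a ∈ A, g a) / A.card
  have hθ0 : 0 ≤ θ := by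
    apply pow_nonneg
    rw [sub_nonneg, div_le_one (by positivity)]
    exact_mod_cast card_zhandryModuli_le m
  have havg0 : 0 ≤ avg := div_nonneg (Finset.sum_nonneg fun a _ => hg0 a) (Nat.cast_nonneg _)
  have havg1 : avg ≤ 1 := by
    have hc : (0 : ℝ) < A.card := by exact_mod_cast hA.card_pos
    rw [div_le_one hc]
    calc ∑ a ∈ A, g a ≤ ∑ _a ∈ A, (1 : ℝ) := Finset.sum_le_sum fun a _ => hg1 a
      _ = A.card := by simp
  have hdiff : (1 - θ) * avg + θ * g 0 - avg = θ * (g 0 - avg) := by ring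
  rw [hdiff, abs_mul, abs_of_nonneg hθ0]
  calc θ * |g 0 - avg| ≤ θ * 1 := by
        refine mul_le_mul_of_nonneg_left ?_ hθ0
        rw [abs_le]
        constructor <;> linarith [hg0 0, hg1 0]
    _ = θ := mul_one θ

/-- The miss probability is at most `exp (−T |A| / 2^{⌊m/2⌋})`. [folklore] -/
theorem miss_pow_le_exp (m T : ℕ) :
    (1 - ((zhandryModuli (2 ^ m)).card : ℝ) / 2 ^ bw m) ^ T ≤
      Real.exp (-(T * ((zhandryModuli (2 ^ m)).card / 2 ^ bw m))) := by
  set p : ℝ := ((zhandryModuli (2 ^ m)).card : ℝ) / 2 ^ bw m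
  have hp0 : 0 ≤ p := by positivity
  have hp1 : p ≤ 1 := by
    rw [div_le_one (by positivity)]
    exact_mod_cast card_zhandryModuli_le m
  calc (1 - p) ^ T ≤ (Real.exp (-p)) ^ T := by
        refine pow_le_pow_left₀ (by linarith) ?_ T
        have := Real.add_one_le_exp (-p)
        linarith
    _ = Real.exp (-(T * p)) := by rw [← Real.exp_nat_mul]; ring_nf


/-! ### The sampler as an `FP` string function (brick algebra) -/

section Machine

open Polynomial Plumb OracleCompose
open Literature.Computability.QuantumComplexity (AKSMachine.aksFn AKSMachine.aksFn_mem_FP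
  AKSMachine.aksFn_encodeNat aksFn_decides_PRIMES)
open Literature.NumberTheory.Primality (AKS.aksDecide_eq_true_iff)

/-- Unary numerals are blocks of ones. [folklore] -/
theorem ones_eq_replicate (k : ℕ) : ones k = List.replicate k true := by
  induction k with
  | zero => rfl
  | succ k ih => exact congrArg (List.cons true) ih

/-- `|ones k| = k`. [folklore] -/
theorem length_ones' (k : ℕ) : (ones k).length = k := by
  rw [ones_eq_replicate, List.length_replicate]

/-- `onesFn q = ones |q|`. [folklore] -/
theorem onesFn_eq_ones (q : List Bool) : onesFn q = ones q.length := by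
  rw [onesFn, OracleCompose.unaryEncodeNat_eq_replicate, ones_eq_replicate]

/-- The canonical numeral of the value of a string: `canonF u = encodeNat ⟦u⟧`. [folklore] -/
def canonF : List Bool → List Bool := addFn ∘ fanoutFn id (fun _ => [])

/-- Value of `canonF`. [folklore] -/
@[simp] theorem canonF_apply (u : List Bool) : canonF u = encodeNat (bitsToNat u) := by
  simp [canonF]

/-- `canonF ∈ FP`. [folklore] -/
theorem canonF_mem_FP : canonF ∈ FP :=
  comp_mem_FP addFn_mem_FP (fanoutFn_mem_FP OracleCompose.id_mem_FP (const_mem_FP _))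

/-- `|canonF u| ≤ |u|`. [folklore] -/
theorem length_canonF_le (u : List Bool) : (canonF u).length ≤ u.length := by
  rw [canonF_apply]; exact length_encodeNat_bitsToNat_le u

/-! #### The loop body

Records `z = ⟨x, ⟨counter, ⟨ρ', res⟩⟩⟩` with the context `x = ⟨ρ, ⟨1ʷ, ⟨lo, hi⟩⟩⟩` (the coin
string as a ruler, the block width in unary, the two ends of the window as numerals) and the
state `⟨ρ', res⟩` (coins not yet read, result so far: `[] = encodeNat 0` for "none yet"). -/

/-- The block width field `1ʷ`. [folklore] -/
def wUF : List Bool → List Bool := nthF 1 ∘ nthF 0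
/-- The lower end `lo` of the window. [folklore] -/
def loF : List Bool → List Bool := nthF 2 ∘ nthF 0
/-- The upper end `hi` of the window. [folklore] -/
def hiF : List Bool → List Bool := sndPow 2 ∘ nthF 0
/-- The unread coins `ρ'`. [folklore] -/
def curF : List Bool → List Bool := nthF 2
/-- The result so far. [folklore] -/
def resF : List Bool → List Bool := sndPow 2
/-- The next block `ρ' ↾ w`. [folklore] -/
def blkF : List Bool → List Bool := takeFn ∘ fanoutFn wUF curF
/-- The coins after the next block `ρ' ⇂ w`. [folklore] -/
def restF : List Bool → List Bool := dropFn ∘ fanoutFn wUF curF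
/-- The candidate: the numeral of the next block. [folklore] -/
def candF : List Bool → List Bool := canonF ∘ blkF
/-- The acceptance test: no result yet, `lo ≤ c`, `c ≤ hi`, and `c` is prime (AKS).
[cite: AgrawalKayalSaxena2004, Thm 4.1 and Thm 5.1] -/
def goodF : List Bool → List Bool :=
  andFn (isNilFn ∘ resF) (andFn (notFn (ltFn ∘ fanoutFn candF loF))
    (andFn (notFn (ltFn ∘ fanoutFn hiF candF)) (AKSMachine.aksFn ∘ candF)))
/-- The loop body: drop the block; record the candidate if it passes the test. [folklore] -/
def body : List Bool → List Bool := fanoutFn restF (iteFn goodF candF resF)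

/-- The AKS brick answers one bit on every input. [cite: AgrawalKayalSaxena2004, Thm 4.1] -/
theorem oneBit_aksFn : OneBit AKSMachine.aksFn := fun w => by
  classical
  by_cases hw : w ∈ Literature.Computability.QuantumComplexity.PRIMES
  · exact ⟨true, (aksFn_decides_PRIMES w).1 hw⟩
  · exact ⟨false, (aksFn_decides_PRIMES w).2 hw⟩

/-- The AKS brick on a canonical numeral decides primality. [cite: AgrawalKayalSaxena2004, Thm 4.1] -/
theorem aksFn_encodeNat_eq (c : ℕ) : AKSMachine.aksFn (encodeNat c) = [decide c.Prime] := by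
  rw [AKSMachine.aksFn_encodeNat]
  congr 1
  by_cases h : c.Prime
  · rw [(AKS.aksDecide_eq_true_iff c).2 h, decide_eq_true h]
  · rw [decide_eq_false h, Bool.eq_false_iff]
    exact fun h' => h ((AKS.aksDecide_eq_true_iff c).1 h')

/-- The test is one bit on every input. [folklore] -/
theorem oneBit_goodF : OneBit goodF :=
  oneBit_andFn (oneBit_isNilFn.comp _) (oneBit_andFn (oneBit_notFn (oneBit_ltFn.comp _))
    (oneBit_andFn (oneBit_notFn (oneBit_ltFn.comp _)) (oneBit_aksFn.comp _)))

/-- `candF ∈ FP`. [folklore] -/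
theorem candF_mem_FP : candF ∈ FP :=
  comp_mem_FP canonF_mem_FP (comp_mem_FP takeFn_mem_FP
    (fanoutFn_mem_FP (comp_mem_FP (nthF_mem_FP 1) (nthF_mem_FP 0)) (nthF_mem_FP 2)))

/-- `goodF ∈ FP`. [folklore] -/
theorem goodF_mem_FP : goodF ∈ FP :=
  andFn_mem_FP (comp_mem_FP isNilFn_mem_FP (sndPow_mem_FP 2))
    (andFn_mem_FP (notFn_mem_FP (comp_mem_FP ltFn_mem_FP (fanoutFn_mem_FP candF_mem_FP
      (comp_mem_FP (nthF_mem_FP 2) (nthF_mem_FP 0)))))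
      (andFn_mem_FP (notFn_mem_FP (comp_mem_FP ltFn_mem_FP (fanoutFn_mem_FP
        (comp_mem_FP (sndPow_mem_FP 2) (nthF_mem_FP 0)) candF_mem_FP)))
        (comp_mem_FP AKSMachine.aksFn_mem_FP candF_mem_FP)))

/-- `body ∈ FP`. [folklore] -/
theorem body_mem_FP : body ∈ FP :=
  fanoutFn_mem_FP (comp_mem_FP dropFn_mem_FP
    (fanoutFn_mem_FP (comp_mem_FP (nthF_mem_FP 1) (nthF_mem_FP 0)) (nthF_mem_FP 2)))
    (iteFn_mem_FP goodF_mem_FP candF_mem_FP (sndPow_mem_FP 2))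

/-- The context string of the scan for domain size `2^m` and coins `ρ`:
`⟨ρ, ⟨1^{⌊m/2⌋}, ⟨⌊√(2^m)⌋/4, ⌊√(2^m)⌋/2⟩⟩⟩`. [cite: AaronsonChen2017, §7.2 (p. 29)] -/
def ctx (m : ℕ) (ρ : List Bool) : List Bool :=
  boolPair ρ (boolPair (ones (bw m)) (boolPair (encodeNat (Nat.sqrt (2 ^ m) / 4))
    (encodeNat (Nat.sqrt (2 ^ m) / 2))))

/-- A record of the scan. [folklore] -/
def rec (m : ℕ) (ρ cnt ρ' : List Bool) (acc : ℕ) : List Bool :=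
  boolPair (ctx m ρ) (boolPair cnt (boolPair ρ' (encodeNat acc)))

/-- Projections of a record. [folklore] -/
theorem wUF_rec (m : ℕ) (ρ cnt ρ' : List Bool) (acc : ℕ) : wUF (rec m ρ cnt ρ' acc) = ones (bw m) := by
  simp [wUF, rec, ctx]

/-- Projections of a record. [folklore] -/
theorem loF_rec (m : ℕ) (ρ cnt ρ' : List Bool) (acc : ℕ) :
    loF (rec m ρ cnt ρ' acc) = encodeNat (Nat.sqrt (2 ^ m) / 4) := by
  simp [loF, rec, ctx, nthF]

/-- Projections of a record. [folklore] -/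
theorem hiF_rec (m : ℕ) (ρ cnt ρ' : List Bool) (acc : ℕ) :
    hiF (rec m ρ cnt ρ' acc) = encodeNat (Nat.sqrt (2 ^ m) / 2) := by
  simp [hiF, rec, ctx, sndPow]

/-- Projections of a record. [folklore] -/
theorem curF_rec (m : ℕ) (ρ cnt ρ' : List Bool) (acc : ℕ) : curF (rec m ρ cnt ρ' acc) = ρ' := by
  simp [curF, rec, nthF]

/-- Projections of a record. [folklore] -/
theorem resF_rec (m : ℕ) (ρ cnt ρ' : List Bool) (acc : ℕ) : resF (rec m ρ cnt ρ' acc) = encodeNat acc := by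
  simp [resF, rec, sndPow]

/-- The block of a record. [folklore] -/
theorem blkF_rec (m : ℕ) (ρ cnt ρ' : List Bool) (acc : ℕ) : blkF (rec m ρ cnt ρ' acc) = ρ'.take (bw m) := by
  rw [blkF, Function.comp_apply, fanoutFn_apply, wUF_rec, curF_rec, takeFn_boolPair, length_ones']

/-- The rest of a record. [folklore] -/
theorem restF_rec (m : ℕ) (ρ cnt ρ' : List Bool) (acc : ℕ) : restF (rec m ρ cnt ρ' acc) = ρ'.drop (bw m) := by
  rw [restF, Function.comp_apply, fanoutFn_apply, wUF_rec, curF_rec, dropFn_boolPair, length_ones']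

/-- The candidate of a record. [folklore] -/
theorem candF_rec (m : ℕ) (ρ cnt ρ' : List Bool) (acc : ℕ) :
    candF (rec m ρ cnt ρ' acc) = encodeNat (bitsToNat (ρ'.take (bw m))) := by
  rw [candF, Function.comp_apply, blkF_rec, canonF_apply]

/-- `encodeNat acc = []` iff `acc = 0`. [folklore] -/
theorem encodeNat_eq_nil_iff (acc : ℕ) : encodeNat acc = [] ↔ acc = 0 :=
  ⟨fun h => by simpa using congrArg bitsToNat h, fun h => h ▸ rfl⟩

/-- The test on a record: it accepts iff no result has been recorded and the block's value is one
of Zhandry's moduli. [cite: AaronsonChen2017, §7.2 (p. 29)] -/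
theorem goodF_rec (m : ℕ) (ρ cnt ρ' : List Bool) (acc : ℕ) :
    goodF (rec m ρ cnt ρ' acc) = [decide (acc = 0 ∧ bitsToNat (ρ'.take (bw m)) ∈ zhandryModuli (2 ^ m))] := by
  set c := bitsToNat (ρ'.take (bw m)) with hc
  have h1 : (isNilFn ∘ resF) (rec m ρ cnt ρ' acc) = [decide (acc = 0)] := by
    rw [Function.comp_apply, resF_rec, isNilFn]
    congr 1
    exact decide_eq_decide.2 (encodeNat_eq_nil_iff acc)
  have h2 : (notFn (ltFn ∘ fanoutFn candF loF)) (rec m ρ cnt ρ' acc) = [!decide (c < Nat.sqrt (2 ^ m) / 4)] := by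
    refine notFn_apply ?_
    rw [Function.comp_apply, fanoutFn_apply, candF_rec, loF_rec, ltFn_boolPair]
    simp [hc]
  have h3 : (notFn (ltFn ∘ fanoutFn hiF candF)) (rec m ρ cnt ρ' acc) = [!decide (Nat.sqrt (2 ^ m) / 2 < c)] := by
    refine notFn_apply ?_
    rw [Function.comp_apply, fanoutFn_apply, candF_rec, hiF_rec, ltFn_boolPair]
    simp [hc]
  have h4 : (AKSMachine.aksFn ∘ candF) (rec m ρ cnt ρ' acc) = [decide c.Prime] := by
    rw [Function.comp_apply, candF_rec, aksFn_encodeNat_eq]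
  rw [goodF, andFn_apply h1 (andFn_apply h2 (andFn_apply h3 h4))]
  congr 1
  rw [Bool.eq_iff_iff]
  simp only [Bool.and_eq_true, Bool.not_eq_true', decide_eq_true_eq, decide_eq_false_iff_not, not_lt,
    mem_zhandryModuli]

/-- The body on a record: one round of the scan. [folklore] -/
theorem body_rec (m : ℕ) (ρ cnt ρ' : List Bool) (acc : ℕ) :
    body (rec m ρ cnt ρ' acc) = boolPair (ρ'.drop (bw m)) (encodeNat (pick m acc (ρ'.take (bw m)))) := by
  have hg := goodF_rec m ρ cnt ρ' acc
  rw [body, fanoutFn_apply, restF_rec]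
  congr 1
  by_cases h : acc = 0 ∧ bitsToNat (ρ'.take (bw m)) ∈ zhandryModuli (2 ^ m)
  · rw [iteFn_apply_true (by rw [hg, decide_eq_true h]), pick, if_pos h, candF_rec]
  · rw [iteFn_apply_false (by rw [hg, decide_eq_false h]), pick, if_neg h, resF_rec]

/-- The loop model of the body is the scan. [folklore] -/
theorem loopModel_body (m : ℕ) (ρ : List Bool) : ∀ (k : ℕ) (ρ' : List Bool) (acc : ℕ),
    loopModel body (ctx m ρ) k (boolPair ρ' (encodeNat acc)) =
      boolPair (ρ'.drop (k * bw m)) (encodeNat (scan m k ρ' acc))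
  | 0, ρ', acc => by
    show boolPair ρ' (encodeNat acc) = _
    rw [zero_mul, List.drop_zero]
    rfl
  | k + 1, ρ', acc => by
    have hb := body_rec m ρ (encodeNat (k + 1)) ρ' acc
    rw [rec] at hb
    show loopModel body (ctx m ρ) k (body (boolPair (ctx m ρ) (boolPair (encodeNat (k + 1))
      (boolPair ρ' (encodeNat acc))))) = _
    rw [hb, loopModel_body m ρ k, List.drop_drop]
    have e1 : scan m k (ρ'.drop (bw m)) (pick m acc (ρ'.take (bw m))) = scan m (k + 1) ρ' acc := rfl
    have e2 : bw m + k * bw m = (k + 1) * bw m := by ring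
    rw [e1, e2]

/-- Growth of the body: `|body z| ≤ |sndPow 1 z| + 2 (|fstF z| + 1)` on every input. [folklore] -/
theorem length_body_le (z : List Bool) : (body z).length ≤ (sndPow 1 z).length + 2 * ((fstF z).length + 1) := by
  have hcur : curF z = fstF (sndPow 1 z) := by simp [curF, nthF, sndPow]
  have hres : resF z = sndF (sndPow 1 z) := by simp [resF, sndPow]
  have hst := length_fstF_sndF_le (sndPow 1 z)
  have hw : (wUF z).length ≤ (fstF z).length := by
    simp only [wUF, Function.comp_apply, nthF_zero]
    exact length_nthF_le 1 _
  have hrest : (restF z).length ≤ (curF z).length := by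
    simp only [restF, Function.comp_apply, fanoutFn_apply, dropFn_boolPair, List.length_drop]
    omega
  have hcand : (candF z).length ≤ (wUF z).length := by
    simp only [candF, blkF, Function.comp_apply, fanoutFn_apply, takeFn_boolPair]
    exact (length_canonF_le _).trans (by simp)
  have hite : (iteFn goodF candF resF z).length ≤ (candF z).length + (resF z).length := by
    obtain ⟨b, hb⟩ := oneBit_goodF z
    cases b
    · rw [iteFn_apply_false hb]; omega
    · rw [iteFn_apply_true hb]; omega
  rw [body, length_fanoutFn]
  rw [hcur] at hrest
  rw [hres] at hite
  omega

/-! #### Initialisation and the whole sampler -/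

/-- `1ᵐ` from the input `⟨q, ρ⟩` (`m = |q|`). [folklore] -/
def mUF : List Bool → List Bool := onesFn ∘ fstF
/-- The block width `1^{⌊m/2⌋}`. [folklore] -/
def wU0F : List Bool → List Bool := fstF ∘ divModFn ∘ fanoutFn (fun _ => ones 2) mUF
/-- A numeral of `N = 2^m`: `0ᵐ1`. [folklore] -/
def NF : List Bool → List Bool := concatFn ∘ fanoutFn (Kannan.zerosFn ∘ fstF) (fun _ => [true])
/-- The integer square root of the value of a numeral (`Brick.natSqrt_mem_FP`). [folklore] -/
def sqrtF : List Bool → List Bool := fun w => encodeNat (Nat.sqrt (bitsToNat w))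
/-- `⌊√N⌋` as a numeral. [folklore] -/
def sF : List Bool → List Bool := sqrtF ∘ NF
/-- The lower end `⌊√N⌋/4`. [cite: AaronsonChen2017, §7.2 (p. 29)] -/
def lo0F : List Bool → List Bool := divFn ∘ fanoutFn sF (fun _ => encodeNat 4)
/-- The upper end `⌊√N⌋/2`. [cite: AaronsonChen2017, §7.2 (p. 29)] -/
def hi0F : List Bool → List Bool := divFn ∘ fanoutFn sF (fun _ => encodeNat 2)
/-- The context `⟨ρ, ⟨1ʷ, ⟨lo, hi⟩⟩⟩`. [folklore] -/
def ctxF : List Bool → List Bool := fanoutFn sndF (fanoutFn wU0F (fanoutFn lo0F hi0F))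
/-- The round counter `⌊|ρ|/w⌋` as a numeral. [folklore] -/
def cntF : List Bool → List Bool := Brick.lenBinF ∘ fstF ∘ divModFn ∘ fanoutFn wU0F (onesFn ∘ sndF)
/-- The initial record `⟨x, ⟨counter, ⟨ρ, []⟩⟩⟩`. [folklore] -/
def initF : List Bool → List Bool := fanoutFn ctxF (fanoutFn cntF (fanoutFn sndF (fun _ => [])))
/-- The counted loop (`|x|` rounds available). [folklore] -/
def loopF : List Bool → List Bool := fun z => (loopStep body)^[(X : Polynomial ℕ).eval (fstF z).length] z
/-- **The sampler** `sampF ⟨q, ρ⟩ = encodeNat (samp |q| ⌊|ρ|/w⌋ ρ)`: scan the coin string `ρ` in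
blocks of width `w = ⌊|q|/2⌋` and return (the numeral of) the first block value that is one of
Zhandry's moduli for `N = 2^{|q|}`, or `[]` (zero) if there is none. [folklore] -/
def sampF : List Bool → List Bool := sndPow 2 ∘ loopF ∘ initF

/-- `0ᵐ1` reads as `2^m`. [folklore] -/
theorem bitsToNat_replicate_false_append_true (m : ℕ) :
    bitsToNat (List.replicate m false ++ [true]) = 2 ^ m := by
  rw [bitsToNat_append, bitsToNat_replicate_false, List.length_replicate]
  simp

/-- The block width field on `⟨q, ρ⟩`. [folklore] -/
theorem wU0F_apply (q ρ : List Bool) : wU0F (boolPair q ρ) = ones (bw q.length) := by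
  simp only [wU0F, mUF, Function.comp_apply, fanoutFn_apply, fstF_boolPair, onesFn_eq_ones,
    divModFn_boolPair, bw]

/-- The context on `⟨q, ρ⟩`. [folklore] -/
theorem ctxF_apply (q ρ : List Bool) : ctxF (boolPair q ρ) = ctx q.length ρ := by
  have hs : sF (boolPair q ρ) = encodeNat (Nat.sqrt (2 ^ q.length)) := by
    simp [sF, sqrtF, NF, bitsToNat_replicate_false_append_true]
  simp [ctxF, ctx, wU0F_apply, lo0F, hi0F, hs]

/-- The counter on `⟨q, ρ⟩`. [folklore] -/
theorem cntF_apply (q ρ : List Bool) : cntF (boolPair q ρ) = encodeNat (ρ.length / bw q.length) := by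
  simp only [cntF, Function.comp_apply, fanoutFn_apply, wU0F_apply, sndF_boolPair, onesFn_eq_ones,
    divModFn_boolPair, fstF_boolPair, Brick.lenBinF_apply, length_ones']

/-- **Value of the sampler.** [folklore] -/
theorem sampF_apply (q ρ : List Bool) :
    sampF (boolPair q ρ) = encodeNat (samp q.length (ρ.length / bw q.length) ρ) := by
  have hinit : initF (boolPair q ρ) =
      boolPair (ctx q.length ρ) (boolPair (encodeNat (ρ.length / bw q.length)) (boolPair ρ (encodeNat 0))) := by
    simp only [initF, fanoutFn_apply, ctxF_apply, cntF_apply, sndF_boolPair]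
    rfl
  have hrounds : ρ.length / bw q.length ≤ (X : Polynomial ℕ).eval (ctx q.length ρ).length := by
    rw [eval_X, ctx, length_boolPair]
    have := Nat.div_le_self ρ.length (bw q.length)
    omega
  simp only [sampF, loopF, Function.comp_apply]
  rw [hinit, fstF_boolPair, iterate_loopStep body _ _ _ _ hrounds, loopModel_body]
  simp [samp]

/-- **The sampler is polynomial-time.** [cite: AroraBarakCC2009, §1.3] -/
theorem sampF_mem_FP : sampF ∈ FP := by
  have hsqrt : sqrtF ∈ FP := natSqrt_mem_FP
  have hs : sF ∈ FP := comp_mem_FP hsqrt (comp_mem_FP concatFn_mem_FP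
    (fanoutFn_mem_FP (comp_mem_FP Kannan.zerosFn_mem_FP fstF_mem_FP) (const_mem_FP _)))
  have hw : wU0F ∈ FP := comp_mem_FP fstF_mem_FP (comp_mem_FP divModFn_mem_FP
    (fanoutFn_mem_FP (const_mem_FP _) (comp_mem_FP onesFn_mem_FP fstF_mem_FP)))
  have hctx : ctxF ∈ FP := fanoutFn_mem_FP sndF_mem_FP (fanoutFn_mem_FP hw
    (fanoutFn_mem_FP (comp_mem_FP divFn_mem_FP (fanoutFn_mem_FP hs (const_mem_FP _)))
      (comp_mem_FP divFn_mem_FP (fanoutFn_mem_FP hs (const_mem_FP _)))))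
  have hcnt : cntF ∈ FP := comp_mem_FP Brick.lenBinF_mem_FP (comp_mem_FP fstF_mem_FP
    (comp_mem_FP divModFn_mem_FP (fanoutFn_mem_FP hw (comp_mem_FP onesFn_mem_FP sndF_mem_FP))))
  have hinit : initF ∈ FP := fanoutFn_mem_FP hctx (fanoutFn_mem_FP hcnt
    (fanoutFn_mem_FP sndF_mem_FP (const_mem_FP _)))
  have hloop : loopF ∈ FP := loopFn_mem_FP body_mem_FP length_body_le X
  exact comp_mem_FP (sndPow_mem_FP 2) (comp_mem_FP hloop hinit)

end Machine


/-! ### The query map of the reduction -/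

section QueryMap

open Polynomial Plumb OracleCompose

/-- Strings of equal length and equal value are equal. [folklore] -/
theorem eq_of_length_eq_of_bitsToNat_eq {l₁ l₂ : List Bool} (hl : l₁.length = l₂.length)
    (hv : bitsToNat l₁ = bitsToNat l₂) : l₁ = l₂ := by
  rw [← natBits_length_bitsToNat l₁, ← natBits_length_bitsToNat l₂, hl, hv]

/-- Fixed-width digits are the canonical numeral padded with zeros. [folklore] -/
theorem natBits_eq_encodeNat_append {m v : ℕ} (hv : v < 2 ^ m) :
    Complexity.natBits m v = encodeNat v ++ List.replicate (m - (encodeNat v).length) false := by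
  have hlen : (encodeNat v).length ≤ m := by
    have h := length_encodeNat_bitsToNat_le (Complexity.natBits m v)
    rwa [Complexity.bitsToNat_natBits hv, Complexity.length_natBits] at h
  refine eq_of_length_eq_of_bitsToNat_eq ?_ ?_
  · rw [Complexity.length_natBits, List.length_append, List.length_replicate]
    omega
  · rw [Complexity.bitsToNat_natBits hv, bitsToNat_append, bitsToNat_replicate_false, mul_zero, add_zero,
      bitsToNat_encodeNat]

/-- The output stage `outF ⟨q, r⟩ = (q mod ⟦r⟧)` as a string of length `|q|`, i.e.
`modReduce |q| ⟦r⟧ q`. [cite: AaronsonChen2017, §7.2 (p. 29)] -/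
def outF : List Bool → List Bool :=
  concatFn ∘ fanoutFn remFn (Kannan.zerosFn ∘ dropFn ∘ fanoutFn remFn fstF)

/-- Value of `outF`. [cite: AaronsonChen2017, §7.2 (p. 29)] -/
theorem outF_boolPair (q r : List Bool) : outF (boolPair q r) = modReduce q.length (bitsToNat r) q := by
  have hv : bitsToNat q % bitsToNat r < 2 ^ q.length := lt_of_le_of_lt (Nat.mod_le _ _) (bitsToNat_lt q)
  simp only [outF, Function.comp_apply, fanoutFn_apply, remFn_boolPair, fstF_boolPair, dropFn_boolPair,
    Kannan.zerosFn_apply, List.length_drop, concatFn_boolPair, modReduce]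
  rw [natBits_eq_encodeNat_append hv]

/-- `outF ∈ FP`. [folklore] -/
theorem outF_mem_FP : outF ∈ FP :=
  comp_mem_FP concatFn_mem_FP (fanoutFn_mem_FP remFn_mem_FP (comp_mem_FP Kannan.zerosFn_mem_FP
    (comp_mem_FP dropFn_mem_FP (fanoutFn_mem_FP remFn_mem_FP fstF_mem_FP))))

/-- **The query map of the reduction.** On the step input `z = ⟨⟨u, r⟩, ⟨as, q⟩⟩` of a rewritten
oracle algorithm (input `u` with coins `r`, transcript `as`, intended query `q`) it returns the
reduced query `q mod a` (as a string of length `|q|`), where the modulus `a` is sampled by `sampF`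
from the coins `r ⇂ c(|u|)` left over after the first `c(|u|)` coins. [cite: AaronsonChen2017, App. 13 (p. 42)] -/
def dF (c : Polynomial ℕ) : List Bool → List Bool :=
  outF ∘ fanoutFn (sndPow 1) (sampF ∘ fanoutFn (sndPow 1) (sndF ∘ dropSndFn c ∘ nthF 0))

/-- Value of the query map. [cite: AaronsonChen2017, App. 13 (p. 42)] -/
theorem dF_apply (c : Polynomial ℕ) (u r as q : List Bool) :
    dF c (boolPair (boolPair u r) (boolPair as q)) =
      modReduce q.length (samp q.length ((r.drop (c.eval u.length)).length / bw q.length)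
        (r.drop (c.eval u.length))) q := by
  simp only [dF, Function.comp_apply, fanoutFn_apply, sndPow_succ_boolPair, sndPow_zero_boolPair, nthF_zero,
    fstF_boolPair, dropSndFn_boolPair, sndF_boolPair, sampF_apply, outF_boolPair, bitsToNat_encodeNat]

/-- The query map is polynomial-time. [cite: AroraBarakCC2009, §1.3] -/
theorem dF_mem_FP (c : Polynomial ℕ) : dF c ∈ FP :=
  comp_mem_FP outF_mem_FP (fanoutFn_mem_FP (sndPow_mem_FP 1) (comp_mem_FP sampF_mem_FP
    (fanoutFn_mem_FP (sndPow_mem_FP 1) (comp_mem_FP sndF_mem_FP (comp_mem_FP (dropSndFn_mem_FP c) (nthF_mem_FP 0))))))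

end QueryMap

/-! ### The reduction adversary -/

/-- **The reduction adversary** `B` of the computational step: with `c(n) + S(n)` coins, run `𝒜`
on the first `c(n)` coins (`comap (truncSndFn c)`), rewriting each of its queries `q` into
`q mod a` for a modulus `a` sampled once and for all from the remaining `S(n)` coins (`mapQuery`);
same round budget. Against the oracle of `PRP^raw_k` it plays `𝒜` against `PRF^mod_{(k,a)}`;
against a random function `h` it plays `𝒜` against `h ∘ (mod a)`. [cite: AaronsonChen2017, App. 13 (p. 42)] -/
def redAdv (𝒜 : OracleAdversary Bool) (S : Polynomial ℕ) : OracleAdversary Bool where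
  alg := (𝒜.alg.comap (truncSndFn 𝒜.coins)).mapQuery (dF 𝒜.coins)
  coins := 𝒜.coins + S
  fuel := 𝒜.fuel

/-- The reduction adversary is probabilistic polynomial-time. [cite: AroraBarakCC2009, §3.4 with §1.3] -/
theorem isPPT_redAdv {𝒜 : OracleAdversary Bool} (h𝒜 : 𝒜.IsPPT encodingBoolBool) (S : Polynomial ℕ) :
    (redAdv 𝒜 S).IsPPT encodingBoolBool :=
  OracleAlg.isPolyTime_mapQuery _ (OracleAlg.isPolyTime_comap _ h𝒜 (truncSndFn_mem_FP _)) (dF_mem_FP _)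

/-- Runs of `(M.comap pre).mapQuery d` for a rewriting answered by `O` as the original queries are
by `O₀` (whatever the transcript): they are the runs of `M` on `pre w` with `O₀`. [cite: AroraBarak2009, §3.4] -/
theorem runAux_comap_mapQuery {β : Type} (M : OracleAlg β) (pre d : List Bool → List Bool) (O O₀ : Oracle)
    (w : List Bool) (h : ∀ t q : List Bool, O (d (boolPair w (boolPair t q))) = O₀ q) :
    ∀ (k : ℕ) (as : List (List Bool)),
      ((M.comap pre).mapQuery d).runAux O w k as = M.runAux O₀ (pre w) k as
  | 0, _ => rfl
  | k + 1, as => by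
    rw [OracleAlg.runAux_succ, OracleAlg.runAux_succ]
    have hstep : ((M.comap pre).mapQuery d).step w as =
        match M.step (pre w) as with
        | Sum.inl q => Sum.inl (d (boolPair w (boolPair ((encodingList Bool).listBool.encode as) q)))
        | Sum.inr b => Sum.inr b := rfl
    rw [hstep]
    cases M.step (pre w) as with
    | inr b => rfl
    | inl q =>
      dsimp only
      rw [h, runAux_comap_mapQuery M pre d O O₀ w h k]

/-- `|1ⁿ| = n`. [folklore] -/
theorem length_unaryEncodeNat' (n : ℕ) : (unaryEncodeNat n).length = n :=
  unary_decode_encode_nat n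

/-- **The run identity of the reduction**: against a length-`m` function oracle, `B` with coins
`r` runs as `𝒜` with coins `r ↾ c(n)` against the oracle reduced modulo the modulus sampled from
`r ⇂ c(n)`. [cite: AaronsonChen2017, App. 13 (p. 42)] -/
theorem run_redAdv (𝒜 : OracleAdversary Bool) (S : Polynomial ℕ) {m : ℕ} (h : List Bool → List Bool)
    (n K : ℕ) (r : List Bool) :
    (redAdv 𝒜 S).alg.run (oracleOfFnAt m h) K (boolPair (unaryEncodeNat n) r) =
      𝒜.alg.run (reduceOracle (samp m ((r.drop (𝒜.coins.eval n)).length / bw m) (r.drop (𝒜.coins.eval n)))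
        (oracleOfFnAt m h)) K (boolPair (unaryEncodeNat n) (r.take (𝒜.coins.eval n))) := by
  set ρ := r.drop (𝒜.coins.eval n) with hρ
  have hpre : truncSndFn 𝒜.coins (boolPair (unaryEncodeNat n) r) =
      boolPair (unaryEncodeNat n) (r.take (𝒜.coins.eval n)) := by
    rw [truncSndFn_boolPair, length_unaryEncodeNat']
  have hagree : ∀ t q : List Bool,
      oracleOfFnAt m h (dF 𝒜.coins (boolPair (boolPair (unaryEncodeNat n) r) (boolPair t q))) =
        reduceOracle (samp m (ρ.length / bw m) ρ) (oracleOfFnAt m h) q := by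
    intro t q
    rw [dF_apply, length_unaryEncodeNat', ← hρ, reduceOracle_apply]
    by_cases hq : q.length = m
    · rw [hq]
    · rw [oracleOfFnAt_apply_of_length_ne _ (by rw [length_modReduce]; exact hq),
        oracleOfFnAt_apply_of_length_ne _ (by rw [length_modReduce]; exact hq)]
  unfold OracleAlg.run
  rw [show (redAdv 𝒜 S).alg = (𝒜.alg.comap (truncSndFn 𝒜.coins)).mapQuery (dF 𝒜.coins) from rfl,
    runAux_comap_mapQuery _ _ _ _ _ _ hagree, hpre]

/-- The acceptance probability of an oracle adversary as the uniform average, over its coins, of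
the indicator of acceptance. [cite: Goldreich2001, §3.6 (Def. 3.6.4)] -/
theorem acceptProb_eq_uniformAvg (𝒜 : OracleAdversary Bool) (O : Oracle) (n : ℕ) :
    𝒜.acceptProb O n = uniformAvg (𝒜.coins.eval n) fun r =>
      if 𝒜.alg.run O (𝒜.fuel.eval n) (boolPair (unaryEncodeNat n) r) = some true then 1 else 0 := by
  classical
  rw [OracleAdversary.acceptProb, outputPMF_toReal_eq_card, length_unaryEncodeNat', uniformAvg,
    Finset.natCast_card_filter]

/-- **The acceptance probability of the reduction** against a length-`m` function oracle: the
average over the sampler's coins of `𝒜`'s acceptance probability against the reduced oracle.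
[cite: AaronsonChen2017, App. 13 (p. 42)] -/
theorem acceptProb_redAdv (𝒜 : OracleAdversary Bool) (S : Polynomial ℕ) {m : ℕ} (h : List Bool → List Bool)
    (n : ℕ) :
    (redAdv 𝒜 S).acceptProb (oracleOfFnAt m h) n =
      uniformAvg (S.eval n) fun ρ =>
        𝒜.acceptProb (reduceOracle (samp m (S.eval n / bw m) ρ) (oracleOfFnAt m h)) n := by
  set O := oracleOfFnAt m h
  set c := 𝒜.coins.eval n
  set s := S.eval n
  set φ : List Bool → List Bool → ℝ := fun t ρ =>
    if 𝒜.alg.run (reduceOracle (samp m (ρ.length / bw m) ρ) O) (𝒜.fuel.eval n)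
        (boolPair (unaryEncodeNat n) t) = some true then 1 else 0 with hφ
  have hcoins : (redAdv 𝒜 S).coins.eval n = c + s := by
    simp [redAdv, c, s]
  have hfuel : (redAdv 𝒜 S).fuel = 𝒜.fuel := rfl
  rw [acceptProb_eq_uniformAvg, hcoins, hfuel]
  have hint : (fun r : List Bool => if (redAdv 𝒜 S).alg.run O (𝒜.fuel.eval n) (boolPair (unaryEncodeNat n) r) =
      some true then (1 : ℝ) else 0) = fun r => φ (r.take c) (r.drop c) := by
    funext r
    rw [run_redAdv]
  rw [hint, uniformAvg_add c s φ, uniformAvg_comm]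
  refine uniformAvg_congr fun ρ hρ => ?_
  simp only [hφ]
  rw [hρ, acceptProb_eq_uniformAvg]

/-- **The reduction is faithful up to the sampling error**: against any length-`m` function
oracle, `B`'s acceptance probability is within `(1 − |A|/2^{⌊m/2⌋})^{⌊S(n)/⌊m/2⌋⌋}` of the average
over `a ∈ A` of `𝒜`'s acceptance probability against the oracle reduced modulo `a`.
[cite: AaronsonChen2017, App. 13 (p. 42)] -/
theorem abs_acceptProb_redAdv_sub_avg_le (𝒜 : OracleAdversary Bool) (S : Polynomial ℕ) {m : ℕ}
    (h : List Bool → List Bool) (n : ℕ) (hA : (zhandryModuli (2 ^ m)).Nonempty) :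
    |(redAdv 𝒜 S).acceptProb (oracleOfFnAt m h) n -
        (∑ a ∈ zhandryModuli (2 ^ m), 𝒜.acceptProb (reduceOracle a (oracleOfFnAt m h)) n) /
          (zhandryModuli (2 ^ m)).card| ≤
      (1 - (zhandryModuli (2 ^ m)).card / 2 ^ bw m) ^ (S.eval n / bw m) := by
  rw [acceptProb_redAdv]
  exact abs_uniformAvg_samp_sub_avg_le m (g := fun a => 𝒜.acceptProb (reduceOracle a (oracleOfFnAt m h)) n)
    (fun a => OracleAdversary.acceptProb_nonneg _ _ _) (fun a => OracleAdversary.acceptProb_le_one _ _ _)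
    (Nat.div_mul_le_self _ _) hA

/-! ### The two games of the reduction -/

/-- The miss probability of the sampler at parameter `n` (domain `2^m`, `S(n)` coins). [folklore] -/
def miss (m s : ℕ) : ℝ :=
  (1 - ((zhandryModuli (2 ^ m)).card : ℝ) / 2 ^ bw m) ^ (s / bw m)

/-- The miss probability is nonnegative. [folklore] -/
theorem miss_nonneg (m s : ℕ) : 0 ≤ miss m s := by
  apply pow_nonneg
  rw [sub_nonneg, div_le_one (by positivity)]
  exact_mod_cast card_zhandryModuli_le m

/-- An average of `θ`-close quantities is `θ`-close to the average. [folklore] -/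
theorem abs_sum_div_sub_sum_div_le {ι : Type} (s : Finset ι) (hs : s.Nonempty) {f g : ι → ℝ} {θ : ℝ}
    (h : ∀ i ∈ s, |f i - g i| ≤ θ) :
    |(∑ i ∈ s, f i) / s.card - (∑ i ∈ s, g i) / s.card| ≤ θ := by
  have hc : (0 : ℝ) < s.card := by exact_mod_cast hs.card_pos
  rw [← sub_div, ← Finset.sum_sub_distrib, abs_div, abs_of_pos hc, div_le_iff₀ hc]
  calc |∑ i ∈ s, (f i - g i)| ≤ ∑ i ∈ s, |f i - g i| := Finset.abs_sum_le_sum_abs _ _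
    _ ≤ ∑ _i ∈ s, θ := Finset.sum_le_sum h
    _ = θ * s.card := by rw [Finset.sum_const, nsmul_eq_mul, mul_comm]

/-- **The real game**: `B` against `PRP^raw_k` is `𝒜` against `PRF^mod_{(k,a)}` up to the sampling
error: `|Pr_k[B^{F_k} = 1] − Pr_{(k,a)}[𝒜^{PRF^mod_{(k,a)}} = 1]| ≤ miss`. [cite: AaronsonChen2017, App. 13 (p. 42)] -/
theorem abs_prfRealProb_redAdv_sub_prfModRealProb_le (F : FunctionEnsemble) (κ ℓ : ℕ → ℕ)
    (𝒜 : OracleAdversary Bool) (S : Polynomial ℕ) (n : ℕ) (hA : (zhandryModuli (2 ^ ℓ n)).Nonempty) :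
    |prfRealProb F κ ℓ (redAdv 𝒜 S) n - prfModRealProb F κ ℓ 𝒜 n| ≤ miss (ℓ n) (S.eval n) := by
  set A := zhandryModuli (2 ^ ℓ n) with hAdef
  have hAc : (0 : ℝ) < A.card := by exact_mod_cast hA.card_pos
  have hmod : prfModRealProb F κ ℓ 𝒜 n =
      (∑ k : List.Vector Bool (κ n), (∑ a ∈ A, 𝒜.acceptProb
        (reduceOracle a (oracleOfFnAt (ℓ n) (F n k.toList))) n) / A.card) / 2 ^ κ n := by
    rw [prfModRealProb, ← Finset.sum_div, div_div, mul_comm]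
    simp_rw [oracleOfFnAt_prfMod]
    rfl
  rw [prfRealProb_eq_sum, hmod]
  have huniv : (Finset.univ : Finset (List.Vector Bool (κ n))).card = 2 ^ κ n := by
    rw [Finset.card_univ, card_vector, Fintype.card_bool]
  have key := abs_sum_div_sub_sum_div_le (Finset.univ : Finset (List.Vector Bool (κ n)))
    Finset.univ_nonempty (θ := miss (ℓ n) (S.eval n))
    (f := fun k => (redAdv 𝒜 S).acceptProb (oracleOfFnAt (ℓ n) (F n k.toList)) n)
    (g := fun k => (∑ a ∈ A, 𝒜.acceptProb (reduceOracle a (oracleOfFnAt (ℓ n) (F n k.toList))) n) / A.card)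
    (fun k _ => abs_acceptProb_redAdv_sub_avg_le 𝒜 S (F n k.toList) n hA)
  rw [huniv] at key
  push_cast at key
  exact key

/-- A table oracle is a length-`a` function oracle. [folklore] -/
theorem oracleOfTable_eq_oracleOfFnAt {a b : ℕ} (H : List.Vector Bool a → List.Vector Bool b) :
    oracleOfTable H = oracleOfFnAt a fun q => if hq : q.length = a then (H ⟨q, hq⟩).toList else [] := by
  funext q
  by_cases hq : q.length = a
  · rw [oracleOfTable_apply_of_length_eq H hq, oracleOfFnAt_apply_of_length_eq _ hq, dif_pos hq]
  · rw [oracleOfTable_apply_of_length_ne H hq, oracleOfFnAt_apply_of_length_ne _ hq]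

/-- **The ideal game**: `B` against a random function `H` is `𝒜` against `H ∘ (mod a)` up to the
sampling error: `|Pr_H[B^H = 1] − (1/|A|) ∑_a Pr_H[𝒜^{H ∘ (mod a)} = 1]| ≤ miss`.
[cite: AaronsonChen2017, App. 13 (p. 42)] -/
theorem abs_prfIdealProb_redAdv_sub_avg_le (ℓ : ℕ → ℕ) (𝒜 : OracleAdversary Bool) (S : Polynomial ℕ) (n : ℕ)
    (hA : (zhandryModuli (2 ^ ℓ n)).Nonempty) :
    |prfIdealProb ℓ ℓ (redAdv 𝒜 S) n -
        (∑ a ∈ zhandryModuli (2 ^ ℓ n), prfIdealModProb ℓ a 𝒜 n) / (zhandryModuli (2 ^ ℓ n)).card| ≤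
      miss (ℓ n) (S.eval n) := by
  classical
  set A := zhandryModuli (2 ^ ℓ n) with hAdef
  set Ω := (List.Vector Bool (ℓ n) → List.Vector Bool (ℓ n))
  have hAc : (0 : ℝ) < A.card := by exact_mod_cast hA.card_pos
  have hΩ : (0 : ℝ) < Fintype.card Ω := by exact_mod_cast Fintype.card_pos
  have hw : ∀ H : Ω, ((randomFunctionPMF (ℓ n) (ℓ n)) H).toReal = 1 / Fintype.card Ω := fun H => by
    rw [randomFunctionPMF_apply, ENNReal.toReal_inv, ENNReal.toReal_natCast, one_div]
  have hideal : prfIdealProb ℓ ℓ (redAdv 𝒜 S) n =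
      (∑ H : Ω, (redAdv 𝒜 S).acceptProb (oracleOfTable H) n) / Fintype.card Ω := by
    rw [prfIdealProb_eq_tsum, tsum_fintype]
    simp_rw [hw]
    rw [Finset.sum_div]
    refine Finset.sum_congr rfl fun H _ => ?_
    ring
  have hmod : (∑ a ∈ A, prfIdealModProb ℓ a 𝒜 n) / A.card =
      (∑ H : Ω, (∑ a ∈ A, 𝒜.acceptProb (reduceOracle a (oracleOfTable H)) n) / A.card) / Fintype.card Ω := by
    simp_rw [prfIdealModProb_eq_tsum, tsum_fintype, hw]
    rw [Finset.sum_comm, Finset.sum_div, Finset.sum_div]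
    refine Finset.sum_congr rfl fun H _ => ?_
    rw [Finset.sum_div, Finset.sum_div, Finset.sum_div]
    refine Finset.sum_congr rfl fun a _ => ?_
    field_simp
  rw [hideal, hmod]
  have huniv : ((Finset.univ : Finset Ω).card : ℝ) = Fintype.card Ω := by rw [Finset.card_univ]
  have key := abs_sum_div_sub_sum_div_le (Finset.univ : Finset Ω) Finset.univ_nonempty
    (θ := miss (ℓ n) (S.eval n))
    (f := fun H => (redAdv 𝒜 S).acceptProb (oracleOfTable H) n)
    (g := fun H => (∑ a ∈ A, 𝒜.acceptProb (reduceOracle a (oracleOfTable H)) n) / A.card)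
    (fun H _ => by
      simp only [oracleOfTable_eq_oracleOfFnAt]
      exact abs_acceptProb_redAdv_sub_avg_le 𝒜 S _ n hA)
  rw [huniv] at key
  exact key


/-! ### Negligibility and the theorem -/

/-- `C · rⁿ` is negligible for `|r| < 1`. [folklore] -/
theorem superpolynomialDecay_const_mul_pow {r : ℝ} (hr : |r| < 1) (C : ℝ) :
    SuperpolynomialDecay atTop (fun n : ℕ => (n : ℝ)) (fun n => C * r ^ n) := by
  intro k
  have h := (tendsto_pow_const_mul_const_pow_of_abs_lt_one k hr).const_mul C
  rw [mul_zero] at h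
  refine h.congr fun n => ?_
  ring

/-- `p(n) · rⁿ` is negligible for a natural polynomial `p` and `|r| < 1`. [folklore] -/
theorem superpolynomialDecay_natPoly_mul_pow (p : Polynomial ℕ) {r : ℝ} (hr : |r| < 1) :
    SuperpolynomialDecay atTop (fun n : ℕ => (n : ℝ)) (fun n => ((p.eval n : ℕ) : ℝ) * r ^ n) := by
  have h0 : SuperpolynomialDecay atTop (fun n : ℕ => (n : ℝ)) (fun n => r ^ n) := by
    have h := superpolynomialDecay_const_mul_pow hr 1
    simpa only [one_mul] using h
  have h1 := h0.polynomial_mul (p.map (Nat.castRingHom ℝ))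
  refine h1.congr fun n => ?_
  rw [Polynomial.eval_map, Polynomial.eval₂_at_natCast]
  simp only [eq_natCast, Nat.cast_id]

/-- `(√2)ⁿ ≤ √2 · 2^{⌊n/2⌋}`. [folklore] -/
theorem sqrt_two_pow_le (n : ℕ) : Real.sqrt 2 ^ n ≤ Real.sqrt 2 * 2 ^ (n / 2) := by
  have h2 : Real.sqrt 2 ^ 2 = 2 := Real.sq_sqrt (by norm_num)
  have hs1 : 1 ≤ Real.sqrt 2 := by
    rw [show (1 : ℝ) = Real.sqrt 1 from Real.sqrt_one.symm]
    exact Real.sqrt_le_sqrt (by norm_num)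
  obtain ⟨j, rfl | rfl⟩ := Nat.even_or_odd' n
  · rw [show 2 * j / 2 = j by omega, pow_mul, h2]
    exact le_mul_of_one_le_left (by positivity) hs1
  · rw [show (2 * j + 1) / 2 = j by omega, pow_succ, pow_mul, h2, mul_comm]

/-- `1/2^{⌊n/2⌋} ≤ √2 · (1/√2)ⁿ`. [folklore] -/
theorem inv_two_pow_half_le (n : ℕ) : ((2 : ℝ) ^ (n / 2))⁻¹ ≤ Real.sqrt 2 * (Real.sqrt 2)⁻¹ ^ n := by
  have hs : 0 < Real.sqrt 2 := Real.sqrt_pos.2 (by norm_num)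
  have hsn : 0 < Real.sqrt 2 ^ n := pow_pos hs n
  have h := sqrt_two_pow_le n
  rw [inv_pow, ← div_eq_mul_inv, le_div_iff₀ hsn, inv_mul_le_iff₀ (by positivity)]
  linarith

/-- The moduli of distinct points of `{0,1}^m`, `m ≥ 14`, collide for at most two of Zhandry's
moduli (vector form of `card_filter_modEq_zhandryModuli_le_two`). [cite: AaronsonChen2017, App. 13 (p. 42)] -/
theorem card_filter_modEq_le_two_vec {m : ℕ} (hm : 14 ≤ m) (v w : List.Vector Bool m) (hvw : v ≠ w) :
    ((zhandryModuli (2 ^ m)).filter fun a => bitsToNat v.toList % a = bitsToNat w.toList % a).card ≤ 2 := by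
  have hv : bitsToNat v.toList < 2 ^ m := by simpa using bitsToNat_lt v.toList
  have hw : bitsToNat w.toList < 2 ^ m := by simpa using bitsToNat_lt w.toList
  exact card_filter_modEq_zhandryModuli_le_two hm hv hw fun heq => hvw (bitsToNat_toList_injective heq)

/-- **The miss probability is exponentially small** once the sampler has `≥ 8m³` coins and `m` is
past the prime-number-theorem threshold `⌊√(2^m)⌋ ≤ 16 m |A|`: `miss ≤ e^{−m}`.
[cite: AaronsonChen2017, App. 13 (p. 42, "`|A| ≥ Ω(√N/log N)`")] -/
theorem miss_le_exp_neg {m s : ℕ} (hm : 2 ≤ m) (hs : 8 * m ^ 3 ≤ s)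
    (hpnt : (Nat.sqrt (2 ^ m) : ℝ) ≤ 16 * m * (zhandryModuli (2 ^ m)).card) :
    miss m s ≤ Real.exp (-(m : ℝ)) := by
  set A := zhandryModuli (2 ^ m) with hAdef
  set T := s / bw m with hT
  have hbw : 0 < bw m := by rw [bw]; omega
  have hTn : 16 * m ^ 2 ≤ T := by
    rw [hT, Nat.le_div_iff_mul_le hbw]
    have h2 : 2 * (m / 2) ≤ m := Nat.mul_div_le m 2
    calc 16 * m ^ 2 * bw m = 8 * m ^ 2 * (2 * (m / 2)) := by rw [bw]; ring
      _ ≤ 8 * m ^ 2 * m := Nat.mul_le_mul_left _ h2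
      _ = 8 * m ^ 3 := by ring
      _ ≤ s := hs
  have hTr : (16 : ℝ) * m ^ 2 ≤ T := by exact_mod_cast hTn
  have hsq : (2 : ℝ) ^ bw m ≤ Nat.sqrt (2 ^ m) := by exact_mod_cast two_pow_bw_le_sqrt m
  have hm0 : (0 : ℝ) < m := by exact_mod_cast (show 0 < m by omega)
  have hpow : (0 : ℝ) < 2 ^ bw m := by positivity
  -- `p ≥ 1/(16 m)`
  set p : ℝ := (A.card : ℝ) / 2 ^ bw m with hp
  have hp16 : 1 / (16 * m) ≤ p := by
    rw [hp, div_le_div_iff₀ (by positivity) hpow]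
    linarith
  have hTp : (m : ℝ) ≤ T * p := by
    calc (m : ℝ) = 16 * m ^ 2 * (1 / (16 * m)) := by field_simp
      _ ≤ T * p := mul_le_mul hTr hp16 (by positivity) (by positivity)
  calc miss m s = (1 - p) ^ T := rfl
    _ ≤ Real.exp (-(T * p)) := miss_pow_le_exp m T
    _ ≤ Real.exp (-(m : ℝ)) := Real.exp_le_exp.2 (by linarith)

/-- **Discharge of `aaronsonChen2017_lem75_prfMod_isPRF`** (Aaronson–Chen 2017, Lemma 7.5 (1),
second half; Zhandry 2012, Claim 1): for a secure `PRP^raw = F` with block length `ℓ n ≥ n`,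
Zhandry's `PRF^mod` is a classically secure PRF. Printed proof (App. 13, p. 42), formalized: the
computational step replaces `PRP^raw_k` by a random function through the reduction adversary
`redAdv` (which samples the modulus itself: rejection sampling with the AKS test, `sampF`), at the
cost of the PRF advantage of `redAdv` against `F` (negligible: `F` is a PRF by the switching lemma,
`IsPRP.isPRF_of_le`) plus twice the miss probability of the sampler (`≤ e^{−m}`, prime number
theorem); the information-theoretic step is `abs_avg_prfIdealModProb_sub_prfIdealProb_le` with
"at most two moduli divide one difference" (`fuel(n)² · 2/|A| = O(q² log N/√N)`).
[cite: AaronsonChen2017, Lemma 7.5 (1) and App. 13 (pp. 30, 42)] -/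
theorem _root_.Literature.Computability.Cryptography.aaronsonChen2017_lem75_prfMod_isPRF_holds :
    aaronsonChen2017_lem75_prfMod_isPRF := by
  intro F κ ℓ hF hℓ 𝒜 h𝒜
  obtain ⟨Q, hQ⟩ := hF.isEfficientFamily.2.1
  -- the sampler's coin budget `8 Q(n)³ ≥ 8 m³`
  set S : Polynomial ℕ := Polynomial.C 8 * Q ^ 3 with hS
  have hSeval : ∀ n, S.eval n = 8 * Q.eval n ^ 3 := fun n => by simp [hS]
  set B := redAdv 𝒜 S with hB
  have hadv : SuperpolynomialDecay atTop (fun n : ℕ => (n : ℝ)) (prfAdvantage F κ ℓ ℓ B) :=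
    (hF.isPRF_of_le hℓ).2 B (isPPT_redAdv h𝒜 S)
  -- the envelope of the remaining error terms
  set r : ℝ := (Real.sqrt 2)⁻¹ with hr
  have hs0 : 0 < Real.sqrt 2 := Real.sqrt_pos.2 (by norm_num)
  have hs1 : 1 < Real.sqrt 2 := by
    rw [show (1 : ℝ) = Real.sqrt 1 from Real.sqrt_one.symm]
    exact Real.sqrt_lt_sqrt (by norm_num) (by norm_num)
  have hr1 : |r| < 1 := by
    rw [hr, abs_of_pos (inv_pos.2 hs0)]
    exact inv_lt_one_of_one_lt₀ hs1
  have he1 : |Real.exp (-1)| < 1 := by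
    rw [abs_of_pos (Real.exp_pos _)]
    exact Real.exp_lt_one_iff.2 (by norm_num)
  set P : Polynomial ℕ := 𝒜.fuel * 𝒜.fuel * Q with hP
  set ε : ℕ → ℝ := fun n => 2 * Real.exp (-1) ^ n + 32 * Real.sqrt 2 * (((P.eval n : ℕ) : ℝ) * r ^ n) with hε
  have hεdecay : SuperpolynomialDecay atTop (fun n : ℕ => (n : ℝ)) ε :=
    (superpolynomialDecay_const_mul_pow he1 2).add
      ((superpolynomialDecay_natPoly_mul_pow P hr1).const_mul (32 * Real.sqrt 2))
  -- thresholds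
  obtain ⟨m₁, hm₁⟩ := exists_sqrt_le_mul_card_zhandryModuli
  obtain ⟨m₂, hm₂⟩ := exists_inv_card_zhandryModuli_le
  refine (hadv.add hεdecay).trans_eventually_abs_le (eventually_atTop.2 ⟨max (max m₁ m₂) 14, fun n hn => ?_⟩)
  -- notation at parameter `n`
  set m := ℓ n with hm
  have hmn : n ≤ m := hℓ n
  have hmQ : m ≤ Q.eval n := (hQ n).2.1
  have hm1 : m₁ ≤ m := le_trans (le_trans (le_max_left _ _) (le_max_left _ _)) (le_trans hn hmn)
  have hm2 : m₂ ≤ m := le_trans (le_trans (le_max_right _ _) (le_max_left _ _)) (le_trans hn hmn)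
  have hm14 : 14 ≤ m := le_trans (le_max_right _ _) (le_trans hn hmn)
  set A := zhandryModuli (2 ^ m) with hAdef
  obtain ⟨hA, hinv⟩ := hm₂ m hm2
  have hpnt := hm₁ m hm1
  set K := 𝒜.fuel.eval n with hK
  -- the four-term bound
  have h1 := abs_prfRealProb_redAdv_sub_prfModRealProb_le F κ ℓ 𝒜 S n hA
  have h3 := abs_prfIdealProb_redAdv_sub_avg_le ℓ 𝒜 S n hA
  have h4 := abs_avg_prfIdealModProb_sub_prfIdealProb_le ℓ 𝒜 n hA (D := 2)
    (fun v w hvw => card_filter_modEq_le_two_vec hm14 v w hvw)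
  have hfour : prfModAdvantage F κ ℓ 𝒜 n ≤
      prfAdvantage F κ ℓ ℓ B n + 2 * miss m (S.eval n) + (K : ℝ) ^ 2 * 2 / A.card := by
    have e1 : prfModAdvantage F κ ℓ 𝒜 n ≤ |prfModRealProb F κ ℓ 𝒜 n - prfRealProb F κ ℓ B n| +
        |prfRealProb F κ ℓ B n - prfIdealProb ℓ ℓ B n| +
        |prfIdealProb ℓ ℓ B n - (∑ a ∈ A, prfIdealModProb ℓ a 𝒜 n) / A.card| +
        |(∑ a ∈ A, prfIdealModProb ℓ a 𝒜 n) / A.card - prfIdealProb ℓ ℓ 𝒜 n| := by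
      unfold prfModAdvantage
      have t1 := abs_sub_le (prfModRealProb F κ ℓ 𝒜 n) (prfRealProb F κ ℓ B n) (prfIdealProb ℓ ℓ 𝒜 n)
      have t2 := abs_sub_le (prfRealProb F κ ℓ B n) (prfIdealProb ℓ ℓ B n) (prfIdealProb ℓ ℓ 𝒜 n)
      have t3 := abs_sub_le (prfIdealProb ℓ ℓ B n) ((∑ a ∈ A, prfIdealModProb ℓ a 𝒜 n) / A.card)
        (prfIdealProb ℓ ℓ 𝒜 n)
      linarith
    have e2 : |prfModRealProb F κ ℓ 𝒜 n - prfRealProb F κ ℓ B n| ≤ miss m (S.eval n) := by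
      rw [abs_sub_comm]; exact h1
    have e3 : |prfRealProb F κ ℓ B n - prfIdealProb ℓ ℓ B n| = prfAdvantage F κ ℓ ℓ B n := rfl
    have e4 : ((𝒜.fuel.eval n : ℕ) : ℝ) ^ 2 * (2 : ℕ) / A.card = (K : ℝ) ^ 2 * 2 / A.card := by
      push_cast; rw [hK]
    linarith [e1, e2, e3, h3, h4, e4.le, e4.ge]
  -- `miss ≤ e^{-n}`
  have hmiss : miss m (S.eval n) ≤ Real.exp (-1) ^ n := by
    have hs : 8 * m ^ 3 ≤ S.eval n := by
      rw [hSeval]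
      exact Nat.mul_le_mul_left 8 (Nat.pow_le_pow_left hmQ 3)
    calc miss m (S.eval n) ≤ Real.exp (-(m : ℝ)) := miss_le_exp_neg (by omega) hs hpnt
      _ ≤ Real.exp (-(n : ℝ)) := Real.exp_le_exp.2 (by simpa using (Nat.cast_le (α := ℝ)).2 hmn)
      _ = Real.exp (-1) ^ n := by rw [← Real.exp_nat_mul]; ring_nf
  -- `K² · 2/|A| ≤ 32 √2 · P(n) · rⁿ`
  have hcoll : (K : ℝ) ^ 2 * 2 / A.card ≤ 32 * Real.sqrt 2 * (((P.eval n : ℕ) : ℝ) * r ^ n) := by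
    have hK0 : (0 : ℝ) ≤ (K : ℝ) ^ 2 := by positivity
    have hsq : (2 : ℝ) ^ bw n ≤ Nat.sqrt (2 ^ m) := by
      have hb : bw n ≤ bw m := Nat.div_le_div_right hmn
      calc (2 : ℝ) ^ bw n ≤ 2 ^ bw m := pow_le_pow_right₀ (by norm_num) hb
        _ ≤ Nat.sqrt (2 ^ m) := by exact_mod_cast two_pow_bw_le_sqrt m
    have hpow : (0 : ℝ) < 2 ^ bw n := by positivity
    have hfrac : (16 : ℝ) * m / Nat.sqrt (2 ^ m) ≤ 16 * Q.eval n / 2 ^ bw n := by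
      have hmQ' : (m : ℝ) ≤ Q.eval n := by exact_mod_cast hmQ
      exact div_le_div₀ (by positivity) (by linarith) hpow hsq
    have hinv' : ((A.card : ℝ))⁻¹ ≤ 16 * Q.eval n * (Real.sqrt 2 * r ^ n) := by
      calc ((A.card : ℝ))⁻¹ ≤ 16 * m / Nat.sqrt (2 ^ m) := hinv
        _ ≤ 16 * Q.eval n / 2 ^ bw n := hfrac
        _ = 16 * Q.eval n * ((2 : ℝ) ^ (n / 2))⁻¹ := by rw [bw, div_eq_mul_inv]
        _ ≤ 16 * Q.eval n * (Real.sqrt 2 * r ^ n) :=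
          mul_le_mul_of_nonneg_left (inv_two_pow_half_le n) (by positivity)
    have hPeval : ((P.eval n : ℕ) : ℝ) = (K : ℝ) ^ 2 * Q.eval n := by
      rw [hP, Polynomial.eval_mul, Polynomial.eval_mul, hK]
      push_cast
      ring
    calc (K : ℝ) ^ 2 * 2 / A.card = (K : ℝ) ^ 2 * 2 * ((A.card : ℝ))⁻¹ := by rw [div_eq_mul_inv]
      _ ≤ (K : ℝ) ^ 2 * 2 * (16 * Q.eval n * (Real.sqrt 2 * r ^ n)) :=
        mul_le_mul_of_nonneg_left hinv' (by positivity)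
      _ = 32 * Real.sqrt 2 * (((P.eval n : ℕ) : ℝ) * r ^ n) := by rw [hPeval]; ring
  -- conclusion
  have hlhs : 0 ≤ prfModAdvantage F κ ℓ 𝒜 n := prfModAdvantage_nonneg F κ ℓ 𝒜 n
  have hbound : prfModAdvantage F κ ℓ 𝒜 n ≤ prfAdvantage F κ ℓ ℓ B n + ε n := by
    have : ε n = 2 * Real.exp (-1) ^ n + 32 * Real.sqrt 2 * (((P.eval n : ℕ) : ℝ) * r ^ n) := rfl
    linarith [hfour, hmiss, hcoll, this]
  show |prfModAdvantage F κ ℓ 𝒜 n| ≤ |prfAdvantage F κ ℓ ℓ B n + ε n|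
  rw [abs_of_nonneg hlhs]
  exact hbound.trans (le_abs_self _)

end ZhandrySampler

end Literature.Computability.Cryptography

end
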